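import Summits.QuantumFields.YangMills.Theorems.FluctuationComparisonRegPrIntLOrganTangentFibreMeanTools
import HarnessLib

/-!
# Crux `FluctuationComparisonRegPrIntL` (stmt-QuantumFields-20520, rung R3), PATH-B organ-tangent lane — TOOLS, GENERIC-CUT EDITION:
# the small-field cutoff TERM of «organ_tangent» for an ARBITRARY ramp `(c₁, c₂)` (R-CUT-χ, ideator ym-r3-idea-1 g26 №3: v2.6 ∕ v17.2 take `(c₁, c₂) = (1∕2, 24∕25)`)

LEAD-20520 width seat ym-ust-20520-w3 g23 (cell ym3-torus), `--supports stmt-QuantumFields-20520` (helper).  THEOREMS ONLY, def-free, [folklore].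

WHY.  ✓`…OrganTangentFibreMeanTools` §4 proves the six properties of the v2–v2.5 cutoff term `∏ p, max 0 (min 1 (3 − 4·dist1(U(∂p))∕θ))`
(ramp from `θ∕2` to `¾θ`).  The (M3) letter of 2026-08-30 (LEAD WORD №1): row VER∘ needs every coarse-window fibre of `descend` to meet `{χ > 0}`,
i.e. exact one-step small lifts with gain `κ√L ≤ c₂` where `c₂θ` is the TOP of the ramp; the tree's certified kernels give `κ√L ≤ 0.9482…` at
`L = 3` (`CertL3Tree.certL3_clause`), `0.860 ∕ 0.805` at `L = 5 ∕ 7` (ANSATZ S) and `≤ 2∕3` for odd `L ≥ 9` (ANSATZ T) — so the top `¾` is served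
for `L ≥ 9` only, while ANY top `c₂ ∈ (0.9483, 1)` is served for EVERY odd `L ≥ 3`.  The ideator's re-cut (token of record, `Lines/runpair_organ.lean`
v17.2 ∕ `Lines/organ_tangent.lean` v2.6):
`sfCut θ U := ∏ p, max 0 (min 1 ((24 ∕ 25 * θ − dist1 (plaqHol U p)) ∕ ((24 ∕ 25 − 1 ∕ 2) * θ)))`.
THIS FILE states the six properties for the GENERIC ramp `∏ p, max 0 (min 1 ((c₂·θ − dist1(U(∂p))) ∕ ((c₂ − c₁)·θ)))`, `c₁ < c₂`, `0 < θ`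
(`= 1` where every `dist1 ≤ c₁θ`, `= 0` as soon as some `dist1 ≥ c₂θ`, `{term ≠ 0} = {term > 0} = {PlaqSmall (c₂θ)}`, continuous, valued in
`[0, 1]`); at `(c₁, c₂) := (1∕2, 24∕25)` the term IS the v2.6 token (syntactically), so consumers (KNIT ∕ E2E ∕ RegularVersion editions) instantiate
and dock by `rfl`.

HONEST FRAMING: elementary real analysis of a fixed polynomial-in-`max∕min` cutoff; nothing of Bałaban's is asserted or proved; VER∘, LIN∘, JEN∘, O1,
crux 20520, `YM3TorusSU2` are NOT proved; the registry `Lines/semiclassical_s2beta.lean` v11.4 (★★OWNER RULING №36) is untouched; rung R3 =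
SU(2) YM₃ on T³ — NOT d = 4, NOT infinite volume, NOT a mass gap, NOT Clay; the Yang–Mills mass gap is NOT proved by any of this.
-/

set_option autoImplicit false

noncomputable section

namespace Summit.QuantumFields.YangMills.Theorems.OrganTangentFibreMeanToolsAnyCut

open Literature.MathematicalPhysics.QuantumFieldTheory.Balaban1983to89
open Summit.QuantumFields.YangMills.Theorems.OrganTangentFibreMeanTools (continuous_dist1_plaqHol)

variable {P : Params} {k : ℕ}

/-- **The generic cutoff term is continuous** (any `c₁ c₂ θ`). [folklore] -/
theorem continuous_sfCutRamp (c₁ c₂ θ : ℝ) :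
    Continuous fun U : GaugeField P k ↥(Matrix.specialUnitaryGroup (Fin 2) ℂ) =>
      ∏ p : Plaq P k, max 0 (min 1 ((c₂ * θ - dist1 (GaugeField.plaqHol U p)) / ((c₂ - c₁) * θ))) :=
  continuous_finsetProd _ fun p _ =>
    continuous_const.max (continuous_const.min
      ((continuous_const.sub (continuous_dist1_plaqHol p)).div_const _))

/-- The generic cutoff term is measurable. [folklore] -/
theorem measurable_sfCutRamp (c₁ c₂ θ : ℝ) :
    Measurable fun U : GaugeField P k ↥(Matrix.specialUnitaryGroup (Fin 2) ℂ) =>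
      ∏ p : Plaq P k, max 0 (min 1 ((c₂ * θ - dist1 (GaugeField.plaqHol U p)) / ((c₂ - c₁) * θ))) := by
  haveI : BorelSpace (GaugeField P k ↥(Matrix.specialUnitaryGroup (Fin 2) ℂ)) := T3OrbitAverage.instBorelSpaceGaugeField
  exact (continuous_sfCutRamp c₁ c₂ θ).measurable

/-- The generic cutoff term is non-negative. [folklore] -/
theorem sfCutRamp_nonneg (c₁ c₂ θ : ℝ) (U : GaugeField P k ↥(Matrix.specialUnitaryGroup (Fin 2) ℂ)) :
    0 ≤ ∏ p : Plaq P k, max 0 (min 1 ((c₂ * θ - dist1 (GaugeField.plaqHol U p)) / ((c₂ - c₁) * θ))) :=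
  Finset.prod_nonneg fun _ _ => le_max_left _ _

/-- The generic cutoff term is at most `1`. [folklore] -/
theorem sfCutRamp_le_one (c₁ c₂ θ : ℝ) (U : GaugeField P k ↥(Matrix.specialUnitaryGroup (Fin 2) ℂ)) :
    ∏ p : Plaq P k, max 0 (min 1 ((c₂ * θ - dist1 (GaugeField.plaqHol U p)) / ((c₂ - c₁) * θ))) ≤ 1 :=
  Finset.prod_le_one (fun _ _ => le_max_left _ _) fun _ _ => max_le zero_le_one (min_le_left _ _)

/-- **The generic cutoff term equals `1` on the closed `c₁`-shell** `{∀ p, dist1 ≤ c₁θ}` (`c₁ < c₂`, `θ > 0`). [folklore] -/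
theorem sfCutRamp_eq_one_of_dist1_le {c₁ c₂ θ : ℝ} (hc : c₁ < c₂) (hθ : 0 < θ)
    (U : GaugeField P k ↥(Matrix.specialUnitaryGroup (Fin 2) ℂ)) (hU : ∀ p, dist1 (GaugeField.plaqHol U p) ≤ c₁ * θ) :
    ∏ p : Plaq P k, max 0 (min 1 ((c₂ * θ - dist1 (GaugeField.plaqHol U p)) / ((c₂ - c₁) * θ))) = 1 := by
  refine Finset.prod_eq_one fun p _ => ?_
  have hden : 0 < (c₂ - c₁) * θ := mul_pos (sub_pos.2 hc) hθ
  have h1 : 1 ≤ (c₂ * θ - dist1 (GaugeField.plaqHol U p)) / ((c₂ - c₁) * θ) := by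
    rw [le_div_iff₀ hden]; nlinarith [hU p]
  rw [min_eq_left h1, max_eq_right zero_le_one]

/-- **… in particular on the open `c₁`-window** `{PlaqSmall (c₁θ)}`. [folklore] -/
theorem sfCutRamp_eq_one_of_plaqSmall {c₁ c₂ θ : ℝ} (hc : c₁ < c₂) (hθ : 0 < θ)
    (U : GaugeField P k ↥(Matrix.specialUnitaryGroup (Fin 2) ℂ)) (hU : PlaqSmall (c₁ * θ) U) :
    ∏ p : Plaq P k, max 0 (min 1 ((c₂ * θ - dist1 (GaugeField.plaqHol U p)) / ((c₂ - c₁) * θ))) = 1 :=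
  sfCutRamp_eq_one_of_dist1_le hc hθ U fun p => (hU p).le

/-- **One plaquette with `dist1 ≥ c₂θ` kills the generic cutoff term** (`c₁ < c₂`, `θ > 0`). [folklore] -/
theorem sfCutRamp_eq_zero_of_le_dist1 {c₁ c₂ θ : ℝ} (hc : c₁ < c₂) (hθ : 0 < θ)
    (U : GaugeField P k ↥(Matrix.specialUnitaryGroup (Fin 2) ℂ)) {p : Plaq P k} (hp : c₂ * θ ≤ dist1 (GaugeField.plaqHol U p)) :
    ∏ p : Plaq P k, max 0 (min 1 ((c₂ * θ - dist1 (GaugeField.plaqHol U p)) / ((c₂ - c₁) * θ))) = 0 := by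
  refine Finset.prod_eq_zero (Finset.mem_univ p) ?_
  have hden : 0 < (c₂ - c₁) * θ := mul_pos (sub_pos.2 hc) hθ
  have h1 : (c₂ * θ - dist1 (GaugeField.plaqHol U p)) / ((c₂ - c₁) * θ) ≤ 0 :=
    div_nonpos_of_nonpos_of_nonneg (by linarith) hden.le
  exact max_eq_left (min_le_of_right_le h1)

/-- **Where the generic cutoff term is non-zero the field is in the `c₂`-window** `{PlaqSmall (c₂θ)}` (`c₁ < c₂`, `θ > 0`). [folklore] -/
theorem plaqSmall_of_sfCutRamp_ne_zero {c₁ c₂ θ : ℝ} (hc : c₁ < c₂) (hθ : 0 < θ)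
    (U : GaugeField P k ↥(Matrix.specialUnitaryGroup (Fin 2) ℂ))
    (hU : ∏ p : Plaq P k, max 0 (min 1 ((c₂ * θ - dist1 (GaugeField.plaqHol U p)) / ((c₂ - c₁) * θ))) ≠ 0) :
    PlaqSmall (c₂ * θ) U := by
  intro p
  by_contra hp
  push Not at hp
  exact hU (sfCutRamp_eq_zero_of_le_dist1 hc hθ U hp)

/-- **The generic cutoff term is positive on the `c₂`-window** `{PlaqSmall (c₂θ)}` (`c₁ < c₂`, `θ > 0`): every factor is positive there. [folklore] -/
theorem sfCutRamp_pos_of_plaqSmall {c₁ c₂ θ : ℝ} (hc : c₁ < c₂) (hθ : 0 < θ)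
    (U : GaugeField P k ↥(Matrix.specialUnitaryGroup (Fin 2) ℂ)) (hU : PlaqSmall (c₂ * θ) U) :
    0 < ∏ p : Plaq P k, max 0 (min 1 ((c₂ * θ - dist1 (GaugeField.plaqHol U p)) / ((c₂ - c₁) * θ))) := by
  refine Finset.prod_pos fun p _ => ?_
  have hden : 0 < (c₂ - c₁) * θ := mul_pos (sub_pos.2 hc) hθ
  have hp : dist1 (GaugeField.plaqHol U p) < c₂ * θ := hU p
  have h1 : 0 < (c₂ * θ - dist1 (GaugeField.plaqHol U p)) / ((c₂ - c₁) * θ) := div_pos (by linarith) hden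
  exact lt_max_of_lt_right (lt_min one_pos h1)

/-- **`{term ≠ 0} = {term > 0} = {PlaqSmall (c₂θ)}`**, the two directions packaged (`c₁ < c₂`, `θ > 0`). [folklore] -/
theorem sfCutRamp_pos_iff_plaqSmall {c₁ c₂ θ : ℝ} (hc : c₁ < c₂) (hθ : 0 < θ)
    (U : GaugeField P k ↥(Matrix.specialUnitaryGroup (Fin 2) ℂ)) :
    0 < ∏ p : Plaq P k, max 0 (min 1 ((c₂ * θ - dist1 (GaugeField.plaqHol U p)) / ((c₂ - c₁) * θ))) ↔ PlaqSmall (c₂ * θ) U :=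
  ⟨fun h => plaqSmall_of_sfCutRamp_ne_zero hc hθ U h.ne', sfCutRamp_pos_of_plaqSmall hc hθ U⟩

/-- **The support of the generic cutoff term sits inside the OPEN fine window** `{PlaqSmall θ}` whenever `c₁ < c₂ < 1`, `θ > 0` — the D25-5
requirement on the re-cut (the closed `c₂`-shell is compact inside the open window). [folklore] -/
theorem tsupport_sfCutRamp_subset {c₁ c₂ θ : ℝ} (hc : c₁ < c₂) (hc2 : c₂ < 1) (hθ : 0 < θ) :
    tsupport (fun U : GaugeField P k ↥(Matrix.specialUnitaryGroup (Fin 2) ℂ) =>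
        ∏ p : Plaq P k, max 0 (min 1 ((c₂ * θ - dist1 (GaugeField.plaqHol U p)) / ((c₂ - c₁) * θ)))) ⊆
      {U | PlaqSmall θ U} :=
  OrganTangentFibreMeanTools.tsupport_subset_plaqSmall (mul_lt_of_lt_one_left hθ hc2)
    fun U hU => plaqSmall_of_sfCutRamp_ne_zero hc hθ U hU

/-- The numerals of the v2.6 token of record satisfy the standing hypotheses: `1∕2 < 24∕25 < 1`. [folklore] -/
theorem half_lt_twentyFour_div_twentyFive_and_lt_one : (1 / 2 : ℝ) < 24 / 25 ∧ (24 / 25 : ℝ) < 1 := by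
  constructor <;> norm_num

end Summit.QuantumFields.YangMills.Theorems.OrganTangentFibreMeanToolsAnyCut

end
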